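import Summits.PneNP.PneNP.Theses.SymmetryBudget
import Literature.Computability.Complexity.HeldKarpSymmetricCircuit

/-!
# `WindowHam` (crux stmt-PneNP-2143): the Held–Karp programme is an exact, rigid, window-symmetric
# HAM circuit with POLYNOMIAL orbits — orbit-only arguments cannot prove the crux (negative-side
# tightness lemma BN-W2, re-exported from `Literature/Computability/Complexity/HeldKarpSymmetricCircuit.lean`)

Support file of the crux disprover (cdisprove seat, cycle 2); nothing positive about any route item.
The crux negates `HasSym m (Bud m ⌊log₂ m⌋) (p m) HAM_m` infinitely often for every polynomial `p`
(poly SIZE). Here: for every `m ≥ 3` (and every budget) an EXACT `Bud`-symmetric `tcBasis` circuit for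
`HAM_m` exists whose orbits (`Circuit.orbitSize`, Dawar–Wilsenach's `ORB`) are polynomial in the window
— so no stub of the shapes "exact / poly-size window-symmetric HAM circuits have a large orbit" or
"polynomial orbits ⇒ cannot compute HAM" can hold, and no orbit-only transfer of the support theorem
/ DW Thm 6.4 proves `WindowHam`: a proof must use the NUMBER of gates.
-/

namespace Summit.PneNP.PneNP.Theorems.WindowHam.Negative

open Literature.Computability.Complexity

open scoped Classical in
/-- **BN-W2 at the window** (kernel-checked): for every `m ≥ 3` some `tcBasis` circuit is
`Bud(m,⌊log₂ m⌋)`-symmetric, rigid, computes the route's `HAM_m` exactly and has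
`orbitSize ≤ max (m·(⌊log₂ m⌋+1)^3) m²`. -/
theorem heldKarp_window_orbits {m : ℕ} (hm : 3 ≤ m) :
    ∃ C : Circuit (Fin m × Fin m), C.IsOver tcBasis ∧
      C.IsSymmetricUnder (pointStabiliserBudget m (Nat.log 2 m)) ∧ C.IsRigid ∧
      C.Computes (fun x : Fin m × Fin m → Bool =>
        decide (SimpleGraph.fromRel fun u v => x (u, v) = true).IsHamiltonian) ∧
      C.orbitSize (pointStabiliserBudget m (Nat.log 2 m)) ≤ max (m * (Nat.log 2 m + 1) ^ 3) (m ^ 2) :=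
  HeldKarp.exists_symmetric_circuit_log hm

open scoped Classical in
/-- **BN-W2 at every budget**: exact rigid `Bud(m,g)`-symmetric HAM circuits with
`orbitSize ≤ max (2^g (g+1)^3) m²`; at `g = m` this is `2^{m+O(log m)}`, i.e. the hypothesis
`ORB = 2^{o(n)}` of Dawar–Wilsenach Thm 6.4 is tight for Hamiltonicity. -/
theorem heldKarp_orbits {m : ℕ} (hm : 3 ≤ m) (g : ℕ) :
    ∃ C : Circuit (Fin m × Fin m), C.IsOver tcBasis ∧
      C.IsSymmetricUnder (pointStabiliserBudget m g) ∧ C.IsRigid ∧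
      C.Computes (fun x : Fin m × Fin m → Bool =>
        decide (SimpleGraph.fromRel fun u v => x (u, v) = true).IsHamiltonian) ∧
      C.orbitSize (pointStabiliserBudget m g) ≤ max (2 ^ g * (g + 1) ^ 3) (m ^ 2) :=
  HeldKarp.exists_symmetric_circuit hm g

open scoped Classical in
/-- **The orbit-lower-bound stub shape is FALSE**: it is not the case that for some `m ≥ 3` every exact
`Bud(m,⌊log₂ m⌋)`-symmetric `tcBasis` circuit for `HAM_m` has orbit size above
`max (m·(⌊log₂ m⌋+1)^3) m²`. -/
theorem not_orbitLowerBound_ham :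
    ¬ ∃ m : ℕ, 3 ≤ m ∧ ∀ C : Circuit (Fin m × Fin m), C.IsOver tcBasis →
        C.IsSymmetricUnder (pointStabiliserBudget m (Nat.log 2 m)) →
        C.Computes (fun x : Fin m × Fin m → Bool =>
          decide (SimpleGraph.fromRel fun u v => x (u, v) = true).IsHamiltonian) →
        max (m * (Nat.log 2 m + 1) ^ 3) (m ^ 2) < C.orbitSize (pointStabiliserBudget m (Nat.log 2 m)) := by
  rintro ⟨m, hm, h⟩
  obtain ⟨C, hB, hS, -, hC, hO⟩ := heldKarp_window_orbits hm
  exact absurd (h C hB hS hC) (not_lt.2 hO)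

open scoped Classical in
/-- The predicate negated in the crux is inhabited at size `7·2^m·m³` under EVERY budget (`m ≥ 3`),
by the Held–Karp programme — sharper than the DNF bound `m² + 2^{m²} + 1` of `InvariantDNFHam.lean`. -/
theorem hasSymCircuit_hamFn_heldKarp {m : ℕ} (hm : 3 ≤ m) (g : ℕ) :
    HasSymCircuit tcBasis (pointStabiliserBudget m g) (7 * (2 ^ m * m ^ 3))
      (fun x : Fin m × Fin m → Bool =>
        decide (SimpleGraph.fromRel fun u v => x (u, v) = true).IsHamiltonian) :=
  HeldKarp.hasSymCircuit_ham hm _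

open scoped Classical in
/-- Hence the symmetric circuit complexity of `HAM_m` is at most `7·2^m·m³` under any permutation set. -/
theorem symCircuitSizeOver_hamFn_le_heldKarp {m : ℕ} (hm : 3 ≤ m) (Γ : Set (Equiv.Perm (Fin m))) :
    symCircuitSizeOver tcBasis Γ
        (fun x : Fin m × Fin m → Bool =>
          decide (SimpleGraph.fromRel fun u v => x (u, v) = true).IsHamiltonian)
      ≤ 7 * (2 ^ m * m ^ 3) := by
  obtain ⟨C, hB, hs, hΓ, hf⟩ := HeldKarp.hasSymCircuit_ham hm Γ
  exact (symCircuitSizeOver_le_of_computes C hB hΓ hf).trans hs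

end Summit.PneNP.PneNP.Theorems.WindowHam.Negative
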